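import Mathlib.Analysis.SpecialFunctions.JapaneseBracket
import Mathlib.Analysis.InnerProductSpace.PiL2
import Mathlib.MeasureTheory.Group.Integral
import Mathlib.MeasureTheory.Integral.Bochner.Basic
import HarnessLib

/-!
# Polynomial Fourier weights `(1 + ‖ξ‖)^K` and the Leray-projected derivative symbol

First file of the Fourier-side construction of Leray's local regular solution of the
Navier–Stokes equations on `ℝ³` (discharge of `Literature.Fluid.local_regular_solution`,
`Literature.Analysis.FluidPDE.NSLocalRegular`; plan in that file). The solution is built as
`u(t, x) = ∫ e^{2πi⟨x,ξ⟩} v(t, ξ) dξ`, `v` being the fixed point of a Picard iteration for the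
Fourier-transformed (mild) Navier–Stokes system in weighted sup-norms
`sup_ξ (1 + ‖ξ‖)^K ‖v(t, ξ)‖` (the "pseudo-measure"/weighted-`L^∞` setting on the Fourier side:
Le Jan–Sznitman 1997; Cannone, Handbook of Mathematical Fluid Dynamics III (2004), §§2.4–2.5;
Lemarié-Rieusset 2016, §8.5; for Leray's theorem itself Leray 1934 §19, Ożański–Pooley 2018
Thm. 6.22).

This file provides the elementary real-variable ingredients every later estimate uses:

* the **Peetre / Japanese-bracket convolution bound**
  `∫ (1 + ‖ξ - η‖)^{-K} (1 + ‖η‖)^{-K} dη ≤ 2^{K+1} I_K (1 + ‖ξ‖)^{-K}`,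
  `I_K = ∫ (1 + ‖η‖)^{-K} dη < ∞` for `K > dim E` (Mathlib `integrable_one_add_norm`), as a
  domination lemma for integrands bounded by the product of the two weights
  (`norm_integral_le_of_norm_le_weight_mul_weight`), and its **mixed-weight** form
  `norm_integral_le_of_mixed`: if `f`, `g` decay to the integrable order `K₀ > dim E` and to an
  arbitrary order `K`, their convolution decays to order `K` with a bound linear in the order-`K`
  constants (the estimate that propagates all polynomial weights on one time interval);
* the **heat gain** `r ∫₀ᵗ e^{-c r²(t-s)} e^{λ s} ds ≤ e^{λt}/(2√(cλ))` (`heatGain_le`): the heat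
  factor recovers the one derivative of the Navier–Stokes nonlinearity, uniformly in the
  frequency `r = ‖ξ‖`, at the price `λ^{-1/2}` in an exponential time weight;
* the **Leray-projected derivative symbol** on `EuclideanSpace ℝ ι`,
  `lerayDerivSymbol j k l ξ = ξⱼ (δₖₗ − ξₖ ξₗ / ‖ξ‖²)` — the Fourier multiplier of
  `w ↦ (ℙ ∂ⱼ w)` between components `k` and `l`, `ℙ` the Leray projector with symbol
  `δₖₗ − ξₖξₗ/‖ξ‖²` (Lemarié-Rieusset 2016, §6.1; cf. `Literature.Analysis.FluidPDE.leraySymbol`), with its bound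
  `|·| ≤ 2‖ξ‖`, continuity (the value at `ξ = 0` is `0`, which Lean's `x / 0 = 0` delivers),
  oddness, and the incompressibility identity `∑ₗ ξₗ · lerayDerivSymbol j k l ξ = 0`.

## Mathlib search

`integrable_one_add_norm`, `finite_integral_one_add_norm` (JapaneseBracket), `add_pow_le`,
`integral_sub_right_eq_self` (Haar translation invariance), `EuclideanSpace.real_norm_sq_eq`,
`PiLp.norm_apply_le`, `intervalIntegral.integral_eq_sub_of_hasDerivAt`.
No Mathlib declaration for the Peetre inequality in integrated form, for the heat-gain integral
or for the coordinate Leray symbol (searched `Peetre`, `one_add_norm_sub`, `leray`); the tree's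
`Literature.Analysis.FluidPDE.leraySymbol` (LerayProjector) is the operator-valued projector symbol, of which
`lerayDerivSymbol j k l ξ = ξ j * (leraySymbol ξ (single k 1)) l` is the derivative-weighted
matrix entry used coordinatewise here.

## References

* J. Leray, *Sur le mouvement d'un liquide visqueux emplissant l'espace*, Acta Math. 63 (1934),
  §19. [Leray1934]
* W. S. Ożański, B. C. Pooley, *Leray's fundamental work on the Navier–Stokes equations*, in:
  PDE in Fluid Mechanics, LMS LN 452, CUP 2018, Thm. 6.22. [OzanskiPooley2018]
* P. G. Lemarié-Rieusset, *The Navier–Stokes problem in the 21st century*, CRC 2016, §6.1, §8.5.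
-/

noncomputable section

open MeasureTheory Real Set Filter Topology

namespace Literature.Analysis.FluidPDE.FourierNS

/-! ### Pointwise inequalities for the weight `1 + ‖ξ‖` -/

section Weight

variable {E : Type*} [NormedAddCommGroup E]

/-- `0 < 1 + ‖ξ‖`. [folklore] -/
theorem one_add_norm_pos (ξ : E) : 0 < 1 + ‖ξ‖ := by positivity

/-- `1 ≤ 1 + ‖ξ‖`. [folklore] -/
theorem one_le_one_add_norm (ξ : E) : 1 ≤ 1 + ‖ξ‖ := le_add_of_nonneg_right (norm_nonneg _)

/-- `1 ≤ (1 + ‖ξ‖)^K`. [folklore] -/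
theorem one_le_one_add_norm_pow (ξ : E) (K : ℕ) : 1 ≤ (1 + ‖ξ‖) ^ K :=
  one_le_pow₀ (one_le_one_add_norm ξ)

/-- `((1 + ‖ξ‖)^K)⁻¹ ≤ 1`. [folklore] -/
theorem inv_one_add_norm_pow_le_one (ξ : E) (K : ℕ) : ((1 + ‖ξ‖) ^ K)⁻¹ ≤ 1 :=
  inv_le_one_of_one_le₀ (one_le_one_add_norm_pow ξ K)

/-- The inverse weights are antitone in the exponent: `((1+‖ξ‖)^K)⁻¹ ≤ ((1+‖ξ‖)^J)⁻¹` for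
`J ≤ K`. [folklore] -/
theorem inv_one_add_norm_pow_anti (ξ : E) {J K : ℕ} (h : J ≤ K) :
    ((1 + ‖ξ‖) ^ K)⁻¹ ≤ ((1 + ‖ξ‖) ^ J)⁻¹ := by
  have h0 : 0 < (1 + ‖ξ‖) ^ J := by positivity
  exact inv_anti₀ h0 (pow_le_pow_right₀ (one_le_one_add_norm ξ) h)

/-- Peetre's inequality, multiplicative form: `1 + ‖ξ‖ ≤ (1 + ‖ξ - η‖) (1 + ‖η‖)`. [folklore] -/
theorem one_add_norm_le_mul (ξ η : E) : 1 + ‖ξ‖ ≤ (1 + ‖ξ - η‖) * (1 + ‖η‖) := by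
  have h1 : ‖ξ‖ ≤ ‖ξ - η‖ + ‖η‖ := by
    calc ‖ξ‖ = ‖(ξ - η) + η‖ := by rw [sub_add_cancel]
      _ ≤ ‖ξ - η‖ + ‖η‖ := norm_add_le _ _
  nlinarith [norm_nonneg (ξ - η), norm_nonneg η]

/-- Peetre's inequality for the `K`-th powers, additive form:
`(1 + ‖ξ‖)^K ≤ 2^K ((1 + ‖ξ - η‖)^K + (1 + ‖η‖)^K)` (from `(a+b)^K ≤ 2^{K-1}(a^K + b^K)`). [folklore] -/
theorem one_add_norm_pow_le (ξ η : E) (K : ℕ) :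
    (1 + ‖ξ‖) ^ K ≤ 2 ^ K * ((1 + ‖ξ - η‖) ^ K + (1 + ‖η‖) ^ K) := by
  have h1 : 1 + ‖ξ‖ ≤ (1 + ‖ξ - η‖) + (1 + ‖η‖) := by
    have : ‖ξ‖ ≤ ‖ξ - η‖ + ‖η‖ := by
      calc ‖ξ‖ = ‖(ξ - η) + η‖ := by rw [sub_add_cancel]
        _ ≤ ‖ξ - η‖ + ‖η‖ := norm_add_le _ _
    linarith
  have ha : (0 : ℝ) ≤ 1 + ‖ξ - η‖ := by positivity
  have hb : (0 : ℝ) ≤ 1 + ‖η‖ := by positivity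
  calc (1 + ‖ξ‖) ^ K ≤ ((1 + ‖ξ - η‖) + (1 + ‖η‖)) ^ K :=
        pow_le_pow_left₀ (by positivity) h1 K
    _ ≤ 2 ^ (K - 1) * ((1 + ‖ξ - η‖) ^ K + (1 + ‖η‖) ^ K) := add_pow_le ha hb K
    _ ≤ 2 ^ K * ((1 + ‖ξ - η‖) ^ K + (1 + ‖η‖) ^ K) := by
        gcongr
        · norm_num
        · exact Nat.sub_le K 1

/-- Peetre's inequality for the inverse weights: the product of the two shifted inverse weights is
dominated by `2^K (1 + ‖ξ‖)^{-K}` times their sum. [folklore] -/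
theorem inv_mul_inv_le (ξ η : E) (K : ℕ) :
    ((1 + ‖ξ - η‖) ^ K)⁻¹ * ((1 + ‖η‖) ^ K)⁻¹ ≤
      2 ^ K * ((1 + ‖ξ‖) ^ K)⁻¹ * (((1 + ‖ξ - η‖) ^ K)⁻¹ + ((1 + ‖η‖) ^ K)⁻¹) := by
  have ha : (0 : ℝ) < (1 + ‖ξ - η‖) ^ K := by positivity
  have hb : (0 : ℝ) < (1 + ‖η‖) ^ K := by positivity
  have hc : (0 : ℝ) < (1 + ‖ξ‖) ^ K := by positivity
  have h := one_add_norm_pow_le ξ η K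
  rw [← sub_nonneg] at h ⊢
  have key : 2 ^ K * ((1 + ‖ξ‖) ^ K)⁻¹ * (((1 + ‖ξ - η‖) ^ K)⁻¹ + ((1 + ‖η‖) ^ K)⁻¹) -
      ((1 + ‖ξ - η‖) ^ K)⁻¹ * ((1 + ‖η‖) ^ K)⁻¹ =
      (2 ^ K * ((1 + ‖ξ - η‖) ^ K + (1 + ‖η‖) ^ K) - (1 + ‖ξ‖) ^ K) *
        (((1 + ‖ξ‖) ^ K)⁻¹ * ((1 + ‖ξ - η‖) ^ K)⁻¹ * ((1 + ‖η‖) ^ K)⁻¹) := by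
    field_simp
    ring
  rw [key]
  exact mul_nonneg h (by positivity)

end Weight

/-! ### Integrability of the inverse weights and the convolution bound -/

section Integral

variable {E : Type*} [NormedAddCommGroup E] [InnerProductSpace ℝ E] [FiniteDimensional ℝ E]
  [MeasurableSpace E] [BorelSpace E]

/-- `η ↦ (1 + ‖η‖)^{-K}` is integrable on `E` for `K > dim E` (Mathlib `integrable_one_add_norm`,
real-power form, transported to natural powers). [folklore] -/
theorem integrable_inv_one_add_norm_pow {K : ℕ} (hK : Module.finrank ℝ E < K) :
    Integrable (fun η : E => ((1 + ‖η‖) ^ K)⁻¹) := by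
  have h := integrable_one_add_norm (E := E) (μ := volume) (r := (K : ℝ)) (by exact_mod_cast hK)
  refine h.congr (Eventually.of_forall fun η => ?_)
  simp only
  rw [Real.rpow_neg (by positivity), Real.rpow_natCast]

omit [InnerProductSpace ℝ E] [FiniteDimensional ℝ E] [MeasurableSpace E] [BorelSpace E] in
/-- The inverse weight is continuous. [folklore] -/
theorem continuous_inv_one_add_norm_pow (K : ℕ) :
    Continuous (fun η : E => ((1 + ‖η‖) ^ K)⁻¹) :=
  Continuous.inv₀ (by fun_prop) (fun η => by positivity)

/-- `I_K = ∫ (1 + ‖η‖)^{-K} dη`, the total mass of the inverse weight (finite for `K > dim E`). [folklore] -/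
def weightMass (E : Type*) [NormedAddCommGroup E] [InnerProductSpace ℝ E] [FiniteDimensional ℝ E]
    [MeasurableSpace E] [BorelSpace E] (K : ℕ) : ℝ :=
  ∫ η : E, ((1 + ‖η‖) ^ K)⁻¹

/-- `0 ≤ I_K`. [folklore] -/
theorem weightMass_nonneg (K : ℕ) : 0 ≤ weightMass E K :=
  integral_nonneg fun η => by positivity

/-- The Peetre constant `2^{K+1} I_K` of the convolution bound. [folklore] -/
def peetreConst (E : Type*) [NormedAddCommGroup E] [InnerProductSpace ℝ E] [FiniteDimensional ℝ E]
    [MeasurableSpace E] [BorelSpace E] (K : ℕ) : ℝ :=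
  2 ^ (K + 1) * weightMass E K

/-- `0 ≤ 2^{K+1} I_K`. [folklore] -/
theorem peetreConst_nonneg (K : ℕ) : 0 ≤ peetreConst E K :=
  mul_nonneg (by positivity) (weightMass_nonneg K)

/-- **Peetre convolution bound.** For `K > dim E`,
`∫ (1 + ‖ξ - η‖)^{-K} (1 + ‖η‖)^{-K} dη ≤ 2^{K+1} I_K (1 + ‖ξ‖)^{-K}`: integrate
`inv_mul_inv_le` and use translation invariance of Lebesgue measure (Lemarié-Rieusset 2016,
§8.5, the algebra property of the weighted pseudo-measure spaces). [folklore] -/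
theorem integral_inv_mul_inv_le {K : ℕ} (hK : Module.finrank ℝ E < K) (ξ : E) :
    ∫ η, ((1 + ‖ξ - η‖) ^ K)⁻¹ * ((1 + ‖η‖) ^ K)⁻¹ ≤ peetreConst E K * ((1 + ‖ξ‖) ^ K)⁻¹ := by
  have hI := integrable_inv_one_add_norm_pow (E := E) hK
  have hIs : Integrable (fun η : E => ((1 + ‖ξ - η‖) ^ K)⁻¹) := by
    have h := hI.comp_sub_right ξ
    refine h.congr (Eventually.of_forall fun η => ?_)
    simp only [norm_sub_rev η ξ]
  have hsum : Integrable (fun η : E => ((1 + ‖ξ - η‖) ^ K)⁻¹ + ((1 + ‖η‖) ^ K)⁻¹) := hIs.add hI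
  calc ∫ η, ((1 + ‖ξ - η‖) ^ K)⁻¹ * ((1 + ‖η‖) ^ K)⁻¹
      ≤ ∫ η, 2 ^ K * ((1 + ‖ξ‖) ^ K)⁻¹ * (((1 + ‖ξ - η‖) ^ K)⁻¹ + ((1 + ‖η‖) ^ K)⁻¹) := by
        refine integral_mono_of_nonneg (Eventually.of_forall fun η => by positivity)
          (hsum.const_mul _) (Eventually.of_forall fun η => inv_mul_inv_le ξ η K)
    _ = 2 ^ K * ((1 + ‖ξ‖) ^ K)⁻¹ * (2 * weightMass E K) := by
        rw [integral_const_mul, integral_add hIs hI]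
        congr 1
        have h1 : ∫ η, ((1 + ‖ξ - η‖) ^ K)⁻¹ = weightMass E K := by
          have h := integral_sub_right_eq_self (μ := (volume : Measure E))
            (fun η : E => ((1 + ‖η‖) ^ K)⁻¹) ξ
          rw [weightMass, ← h]
          congr 1 with η
          rw [norm_sub_rev]
        rw [h1, weightMass]
        ring
    _ = peetreConst E K * ((1 + ‖ξ‖) ^ K)⁻¹ := by
        rw [peetreConst, pow_succ]
        ring

variable {F : Type*} [NormedAddCommGroup F] [NormedSpace ℝ F]

omit [NormedSpace ℝ F] in
/-- **Domination by the two weights.** If `‖G η‖ ≤ A (1 + ‖ξ - η‖)^{-K} · B (1 + ‖η‖)^{-K}`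
with `A, B ≥ 0`, `K > dim E`, and `G` is a.e.-strongly measurable, then `G` is integrable. [folklore] -/
theorem integrable_of_norm_le_weight_mul_weight {K : ℕ} (hK : Module.finrank ℝ E < K) {ξ : E}
    {G : E → F} (hG : AEStronglyMeasurable G volume) {A B : ℝ} (hA : 0 ≤ A) (hB : 0 ≤ B)
    (hle : ∀ η, ‖G η‖ ≤ A * ((1 + ‖ξ - η‖) ^ K)⁻¹ * (B * ((1 + ‖η‖) ^ K)⁻¹)) :
    Integrable G := by
  have hI := integrable_inv_one_add_norm_pow (E := E) hK
  refine Integrable.mono' (hI.const_mul (A * B)) hG (Eventually.of_forall fun η => ?_)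
  calc ‖G η‖ ≤ A * ((1 + ‖ξ - η‖) ^ K)⁻¹ * (B * ((1 + ‖η‖) ^ K)⁻¹) := hle η
    _ ≤ A * 1 * (B * ((1 + ‖η‖) ^ K)⁻¹) := by
        gcongr
        exact inv_one_add_norm_pow_le_one _ _
    _ = A * B * ((1 + ‖η‖) ^ K)⁻¹ := by ring

/-- **Weighted convolution estimate.** If `‖G η‖ ≤ A (1 + ‖ξ - η‖)^{-K} · B (1 + ‖η‖)^{-K}` with
`A, B ≥ 0` and `K > dim E`, then `‖∫ G‖ ≤ 2^{K+1} I_K · A B (1 + ‖ξ‖)^{-K}`: the convolution of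
two functions decaying like `(1 + ‖·‖)^{-K}` decays like `(1 + ‖·‖)^{-K}` (Lemarié-Rieusset 2016,
§8.5). [folklore] -/
theorem norm_integral_le_of_norm_le_weight_mul_weight {K : ℕ} (hK : Module.finrank ℝ E < K)
    {ξ : E} {G : E → F} {A B : ℝ} (hA : 0 ≤ A) (hB : 0 ≤ B)
    (hle : ∀ η, ‖G η‖ ≤ A * ((1 + ‖ξ - η‖) ^ K)⁻¹ * (B * ((1 + ‖η‖) ^ K)⁻¹)) :
    ‖∫ η, G η‖ ≤ peetreConst E K * (A * B) * ((1 + ‖ξ‖) ^ K)⁻¹ := by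
  have hI := integrable_inv_one_add_norm_pow (E := E) hK
  have hprod : Integrable (fun η : E => ((1 + ‖ξ - η‖) ^ K)⁻¹ * ((1 + ‖η‖) ^ K)⁻¹) := by
    refine Integrable.mono' hI ((((continuous_inv_one_add_norm_pow K).comp
      (continuous_const.sub continuous_id)).mul
      (continuous_inv_one_add_norm_pow K)).aestronglyMeasurable) (Eventually.of_forall fun η => ?_)
    rw [Real.norm_of_nonneg (by positivity)]
    calc ((1 + ‖ξ - η‖) ^ K)⁻¹ * ((1 + ‖η‖) ^ K)⁻¹ ≤ 1 * ((1 + ‖η‖) ^ K)⁻¹ := by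
          gcongr; exact inv_one_add_norm_pow_le_one _ _
      _ = ((1 + ‖η‖) ^ K)⁻¹ := one_mul _
  calc ‖∫ η, G η‖ ≤ ∫ η, A * ((1 + ‖ξ - η‖) ^ K)⁻¹ * (B * ((1 + ‖η‖) ^ K)⁻¹) :=
        norm_integral_le_of_norm_le (by simpa [mul_assoc, mul_left_comm] using
          (hprod.const_mul (A * B))) (Eventually.of_forall hle)
    _ = A * B * ∫ η, ((1 + ‖ξ - η‖) ^ K)⁻¹ * ((1 + ‖η‖) ^ K)⁻¹ := by
        rw [← integral_const_mul]
        congr 1 with η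
        ring
    _ ≤ A * B * (peetreConst E K * ((1 + ‖ξ‖) ^ K)⁻¹) :=
        mul_le_mul_of_nonneg_left (integral_inv_mul_inv_le hK ξ) (mul_nonneg hA hB)
    _ = peetreConst E K * (A * B) * ((1 + ‖ξ‖) ^ K)⁻¹ := by ring

end Integral


/-! ### Mixed-weight convolution estimate (propagation of higher decay) -/

section Mixed

variable {E : Type*} [NormedAddCommGroup E] [InnerProductSpace ℝ E] [FiniteDimensional ℝ E]
  [MeasurableSpace E] [BorelSpace E]
variable {F F₁ F₂ : Type*} [NormedAddCommGroup F] [NormedAddCommGroup F₁] [NormedAddCommGroup F₂]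

omit [InnerProductSpace ℝ E] [FiniteDimensional ℝ E] [MeasurableSpace E] [BorelSpace E] in
/-- Pointwise mixed-weight bound for a convolution integrand: if `f` decays to orders `K₀` and
`K` (constants `A₀`, `A`) and `g` likewise (constants `B₀`, `B`), then
`‖f η‖ ‖g (ξ - η)‖ ≤ 2^K (1+‖ξ‖)^{-K} (A B₀ (1+‖ξ-η‖)^{-K₀} + A₀ B (1+‖η‖)^{-K₀})`
(Peetre: `(1+‖ξ‖)^K ≤ 2^K((1+‖ξ-η‖)^K + (1+‖η‖)^K)`, the high weight falling on one factor at a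
time; Lemarié-Rieusset 2016, §8.5). [folklore] -/
theorem norm_mul_norm_le_mixed {K K₀ : ℕ} {ξ η : E} {f : E → F₁} {g : E → F₂}
    {A₀ A B₀ B : ℝ} (hA : 0 ≤ A) (hB : 0 ≤ B)
    (hf₀ : ‖f η‖ ≤ A₀ * ((1 + ‖η‖) ^ K₀)⁻¹) (hf : ‖f η‖ ≤ A * ((1 + ‖η‖) ^ K)⁻¹)
    (hg₀ : ‖g (ξ - η)‖ ≤ B₀ * ((1 + ‖ξ - η‖) ^ K₀)⁻¹)
    (hg : ‖g (ξ - η)‖ ≤ B * ((1 + ‖ξ - η‖) ^ K)⁻¹) :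
    ‖f η‖ * ‖g (ξ - η)‖ ≤ 2 ^ K * ((1 + ‖ξ‖) ^ K)⁻¹ *
      (A * B₀ * ((1 + ‖ξ - η‖) ^ K₀)⁻¹ + A₀ * B * ((1 + ‖η‖) ^ K₀)⁻¹) := by
  set a := 1 + ‖ξ - η‖ with ha_def
  set b := 1 + ‖η‖ with hb_def
  set P := ‖f η‖
  set Q := ‖g (ξ - η)‖
  have ha : 0 < a := by positivity
  have hb : 0 < b := by positivity
  have haK : 0 < a ^ K := by positivity
  have hbK : 0 < b ^ K := by positivity
  have hξK : 0 < (1 + ‖ξ‖) ^ K := by positivity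
  have hP : 0 ≤ P := norm_nonneg _
  have hQ : 0 ≤ Q := norm_nonneg _
  -- the high weights are absorbed by one factor each
  have h1 : a ^ K * Q ≤ B := by
    have := mul_le_mul_of_nonneg_left hg haK.le
    calc a ^ K * Q ≤ a ^ K * (B * (a ^ K)⁻¹) := this
      _ = B := by field_simp
  have h2 : b ^ K * P ≤ A := by
    have := mul_le_mul_of_nonneg_left hf hbK.le
    calc b ^ K * P ≤ b ^ K * (A * (b ^ K)⁻¹) := this
      _ = A := by field_simp
  have hA₀' : 0 ≤ A₀ * ((1 + ‖η‖) ^ K₀)⁻¹ := le_trans hP hf₀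
  have hB₀' : 0 ≤ B₀ * ((1 + ‖ξ - η‖) ^ K₀)⁻¹ := le_trans hQ hg₀
  have key : (1 + ‖ξ‖) ^ K * (P * Q) ≤
      2 ^ K * (A * (B₀ * ((1 + ‖ξ - η‖) ^ K₀)⁻¹) + (A₀ * ((1 + ‖η‖) ^ K₀)⁻¹) * B) := by
    calc (1 + ‖ξ‖) ^ K * (P * Q) ≤ 2 ^ K * (a ^ K + b ^ K) * (P * Q) :=
          mul_le_mul_of_nonneg_right (one_add_norm_pow_le ξ η K) (mul_nonneg hP hQ)
      _ = 2 ^ K * ((a ^ K * Q) * P + (b ^ K * P) * Q) := by ring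
      _ ≤ 2 ^ K * (B * (A₀ * ((1 + ‖η‖) ^ K₀)⁻¹) + A * (B₀ * ((1 + ‖ξ - η‖) ^ K₀)⁻¹)) := by
          gcongr
      _ = 2 ^ K * (A * (B₀ * ((1 + ‖ξ - η‖) ^ K₀)⁻¹) + (A₀ * ((1 + ‖η‖) ^ K₀)⁻¹) * B) := by
          ring
  rw [mul_comm] at key
  have := (le_div_iff₀ hξK).2 key
  calc P * Q ≤ 2 ^ K * (A * (B₀ * ((1 + ‖ξ - η‖) ^ K₀)⁻¹) + (A₀ * ((1 + ‖η‖) ^ K₀)⁻¹) * B) /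
        (1 + ‖ξ‖) ^ K := this
    _ = 2 ^ K * ((1 + ‖ξ‖) ^ K)⁻¹ *
        (A * B₀ * ((1 + ‖ξ - η‖) ^ K₀)⁻¹ + A₀ * B * ((1 + ‖η‖) ^ K₀)⁻¹) := by
        rw [div_eq_mul_inv]; ring

/-- The translated inverse weight has the same mass: `∫ (1 + ‖ξ - η‖)^{-K} dη = I_K`
(translation invariance of Lebesgue measure). [folklore] -/
theorem integral_inv_one_add_norm_sub_pow (K : ℕ) (ξ : E) :
    ∫ η, ((1 + ‖ξ - η‖) ^ K)⁻¹ = weightMass E K := by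
  have h := integral_sub_right_eq_self (μ := (volume : Measure E))
    (fun η : E => ((1 + ‖η‖) ^ K)⁻¹) ξ
  rw [weightMass, ← h]
  congr 1 with η
  rw [norm_sub_rev]

/-- The translated inverse weight is integrable for `K > dim E`. [folklore] -/
theorem integrable_inv_one_add_norm_sub_pow {K : ℕ} (hK : Module.finrank ℝ E < K) (ξ : E) :
    Integrable (fun η : E => ((1 + ‖ξ - η‖) ^ K)⁻¹) := by
  have h := (integrable_inv_one_add_norm_pow (E := E) hK).comp_sub_right ξ
  refine h.congr (Eventually.of_forall fun η => ?_)
  simp only [norm_sub_rev η ξ]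

variable [NormedSpace ℝ F]

/-- **Mixed-weight convolution estimate.** Let `K₀ > dim E`. If `‖f‖ ≤ A₀ (1+‖·‖)^{-K₀}`,
`‖f‖ ≤ A (1+‖·‖)^{-K}`, `‖g‖ ≤ B₀ (1+‖·‖)^{-K₀}`, `‖g‖ ≤ B (1+‖·‖)^{-K}` and
`‖G η‖ ≤ ‖f η‖ ‖g (ξ - η)‖` with `G` a.e.-strongly measurable, then `G` is integrable and
`‖∫ G‖ ≤ 2^K I_{K₀} (A B₀ + A₀ B) (1 + ‖ξ‖)^{-K}`: the convolution of two functions with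
decay of order `K` (and of the integrable order `K₀`) again decays to order `K`, with a bound
*linear* in the order-`K` constants — the estimate that propagates every polynomial Fourier
weight along the Picard iteration on one and the same time interval (Lemarié-Rieusset 2016,
§8.5). [folklore] -/
theorem norm_integral_le_of_mixed {K K₀ : ℕ} (hK₀ : Module.finrank ℝ E < K₀) {ξ : E}
    {G : E → F} {f : E → F₁} {g : E → F₂} {A₀ A B₀ B : ℝ} (hA : 0 ≤ A) (hB : 0 ≤ B)
    (hf₀ : ∀ η, ‖f η‖ ≤ A₀ * ((1 + ‖η‖) ^ K₀)⁻¹) (hf : ∀ η, ‖f η‖ ≤ A * ((1 + ‖η‖) ^ K)⁻¹)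
    (hg₀ : ∀ ζ, ‖g ζ‖ ≤ B₀ * ((1 + ‖ζ‖) ^ K₀)⁻¹) (hg : ∀ ζ, ‖g ζ‖ ≤ B * ((1 + ‖ζ‖) ^ K)⁻¹)
    (hG : AEStronglyMeasurable G volume) (hle : ∀ η, ‖G η‖ ≤ ‖f η‖ * ‖g (ξ - η)‖) :
    Integrable G ∧
      ‖∫ η, G η‖ ≤ 2 ^ K * weightMass E K₀ * (A * B₀ + A₀ * B) * ((1 + ‖ξ‖) ^ K)⁻¹ := by
  set bound : E → ℝ := fun η => 2 ^ K * ((1 + ‖ξ‖) ^ K)⁻¹ *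
      (A * B₀ * ((1 + ‖ξ - η‖) ^ K₀)⁻¹ + A₀ * B * ((1 + ‖η‖) ^ K₀)⁻¹) with hbound
  have hI := integrable_inv_one_add_norm_pow (E := E) hK₀
  have hIs := integrable_inv_one_add_norm_sub_pow (E := E) hK₀ ξ
  have hbi : Integrable bound :=
    ((hIs.const_mul (A * B₀)).add (hI.const_mul (A₀ * B))).const_mul _
  have hle' : ∀ η, ‖G η‖ ≤ bound η := fun η =>
    (hle η).trans (norm_mul_norm_le_mixed hA hB (hf₀ η) (hf η) (hg₀ _) (hg _))
  refine ⟨Integrable.mono' hbi hG (Eventually.of_forall hle'), ?_⟩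
  calc ‖∫ η, G η‖ ≤ ∫ η, bound η := norm_integral_le_of_norm_le hbi (Eventually.of_forall hle')
    _ = 2 ^ K * ((1 + ‖ξ‖) ^ K)⁻¹ * (A * B₀ * weightMass E K₀ + A₀ * B * weightMass E K₀) := by
        simp only [hbound]
        rw [integral_const_mul, integral_add (hIs.const_mul _) (hI.const_mul _),
          integral_const_mul, integral_const_mul, integral_inv_one_add_norm_sub_pow, weightMass]
    _ = 2 ^ K * weightMass E K₀ * (A * B₀ + A₀ * B) * ((1 + ‖ξ‖) ^ K)⁻¹ := by ring

end Mixed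

/-! ### The heat-kernel time gain -/

section Heat

/-- `∫₀ᵗ e^{-γ (t - s)} ds ≤ 1/γ` for `γ > 0` (the integral is `(1 - e^{-γ t})/γ`). [folklore] -/
theorem integral_exp_neg_mul_sub_le {γ t : ℝ} (hγ : 0 < γ) :
    ∫ s in (0 : ℝ)..t, Real.exp (-γ * (t - s)) ≤ 1 / γ := by
  have hderiv : ∀ s ∈ Set.uIcc (0 : ℝ) t,
      HasDerivAt (fun s => Real.exp (-γ * (t - s)) / γ) (Real.exp (-γ * (t - s))) s := by
    intro s _
    have h1 : HasDerivAt (fun s => -γ * (t - s)) γ s := by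
      simpa using ((hasDerivAt_id s).const_sub t).const_mul (-γ)
    have h2 := (h1.exp).div_const γ
    have h3 : Real.exp (-γ * (t - s)) * γ / γ = Real.exp (-γ * (t - s)) := by
      rw [mul_div_assoc, div_self hγ.ne', mul_one]
    rw [h3] at h2
    exact h2
  have hcont : Continuous fun s => Real.exp (-γ * (t - s)) := by fun_prop
  rw [intervalIntegral.integral_eq_sub_of_hasDerivAt hderiv (hcont.intervalIntegrable _ _)]
  simp only [sub_self, mul_zero, Real.exp_zero]
  have : 0 ≤ Real.exp (-γ * (t - 0)) / γ := by positivity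
  linarith

/-- `∫₀ᵗ e^{-β (t - s)} e^{λ s} ds ≤ e^{λ t}/(β + λ)` for `β ≥ 0`, `λ > 0`. [folklore] -/
theorem integral_exp_neg_mul_sub_mul_exp_le {β lam t : ℝ} (hβ : 0 ≤ β) (hlam : 0 < lam) :
    ∫ s in (0 : ℝ)..t, Real.exp (-β * (t - s)) * Real.exp (lam * s) ≤
      Real.exp (lam * t) / (β + lam) := by
  have hγ : 0 < β + lam := by linarith
  have heq : ∀ s, Real.exp (-β * (t - s)) * Real.exp (lam * s) =
      Real.exp (lam * t) * Real.exp (-(β + lam) * (t - s)) := by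
    intro s
    rw [← Real.exp_add, ← Real.exp_add]
    congr 1; ring
  simp_rw [heq]
  rw [intervalIntegral.integral_const_mul, div_eq_mul_one_div]
  exact mul_le_mul_of_nonneg_left (integral_exp_neg_mul_sub_le hγ) (Real.exp_pos _).le

/-- AM–GM for the heat gain: `r/(c r² + λ) ≤ 1/(2√(c λ))` for `c, λ > 0`, `r ≥ 0`
(`2√(cλ) r ≤ c r² + λ`). [folklore] -/
theorem div_le_inv_two_sqrt {c lam r : ℝ} (hc : 0 < c) (hlam : 0 < lam) :
    r / (c * r ^ 2 + lam) ≤ 1 / (2 * Real.sqrt (c * lam)) := by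
  have hden : 0 < c * r ^ 2 + lam := by positivity
  have hs : 0 < Real.sqrt (c * lam) := Real.sqrt_pos.2 (by positivity)
  rw [div_le_div_iff₀ hden (by positivity), one_mul]
  have hsc : Real.sqrt c ^ 2 = c := Real.sq_sqrt hc.le
  have hsl : Real.sqrt lam ^ 2 = lam := Real.sq_sqrt hlam.le
  have hprod : Real.sqrt (c * lam) = Real.sqrt c * Real.sqrt lam := Real.sqrt_mul hc.le lam
  rw [hprod]
  nlinarith [sq_nonneg (Real.sqrt c * r - Real.sqrt lam), hsc, hsl, Real.sqrt_nonneg c,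
    Real.sqrt_nonneg lam]

/-- **Heat gain.** `r ∫₀ᵗ e^{-c r² (t - s)} e^{λ s} ds ≤ e^{λ t}/(2√(c λ))` for `c, λ > 0`,
`r ≥ 0`: one derivative (`r = ‖ξ‖`) is recovered from the heat factor `e^{-c‖ξ‖²(t-s)}`
uniformly in `ξ`, at the price `λ^{-1/2}` in the time weight `e^{λ t}` (Leray 1934, §19 uses
the physical-space form `∫₀ᵗ (ν(t-s))^{-1/2} ds`; Fourier form: Lemarié-Rieusset 2016, §8.5). [folklore] -/
theorem heatGain_le {c lam t r : ℝ} (hc : 0 < c) (hlam : 0 < lam) (hr : 0 ≤ r) :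
    r * ∫ s in (0 : ℝ)..t, Real.exp (-(c * r ^ 2) * (t - s)) * Real.exp (lam * s) ≤
      Real.exp (lam * t) / (2 * Real.sqrt (c * lam)) := by
  have h1 := integral_exp_neg_mul_sub_mul_exp_le (β := c * r ^ 2) (t := t) (by positivity) hlam
  calc r * ∫ s in (0 : ℝ)..t, Real.exp (-(c * r ^ 2) * (t - s)) * Real.exp (lam * s)
      ≤ r * (Real.exp (lam * t) / (c * r ^ 2 + lam)) := mul_le_mul_of_nonneg_left h1 hr
    _ = Real.exp (lam * t) * (r / (c * r ^ 2 + lam)) := by ring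
    _ ≤ Real.exp (lam * t) * (1 / (2 * Real.sqrt (c * lam))) :=
        mul_le_mul_of_nonneg_left (div_le_inv_two_sqrt hc hlam) (Real.exp_pos _).le
    _ = Real.exp (lam * t) / (2 * Real.sqrt (c * lam)) := by ring

/-- The integrand of the heat gain is nonnegative and its integral over `[0, t]`, `t ≥ 0`, is
monotone in nonnegative multiples: a convenience form of `heatGain_le` for integrands bounded by
`M r e^{λ s}` times the heat factor. [folklore] -/
theorem integral_heat_mul_le {c lam t r M : ℝ} (hc : 0 < c) (hlam : 0 < lam) (ht : 0 ≤ t)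
    (hr : 0 ≤ r) (hM : 0 ≤ M) {φ : ℝ → ℝ}
    (hφ : ∀ s ∈ Set.Icc 0 t, φ s ≤ Real.exp (-(c * r ^ 2) * (t - s)) * (M * r * Real.exp (lam * s)))
    (hφi : IntervalIntegrable φ volume 0 t) :
    ∫ s in (0 : ℝ)..t, φ s ≤ M * (Real.exp (lam * t) / (2 * Real.sqrt (c * lam))) := by
  set g : ℝ → ℝ := fun s => Real.exp (-(c * r ^ 2) * (t - s)) * Real.exp (lam * s) with hg
  have hcont : Continuous g := by simp only [hg]; fun_prop
  have hle : ∀ s ∈ Set.Icc 0 t, φ s ≤ M * r * g s := fun s hs => by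
    calc φ s ≤ _ := hφ s hs
      _ = M * r * g s := by simp only [hg]; ring
  calc ∫ s in (0 : ℝ)..t, φ s ≤ ∫ s in (0 : ℝ)..t, M * r * g s :=
        intervalIntegral.integral_mono_on ht hφi ((hcont.intervalIntegrable 0 t).const_mul (M * r))
          hle
    _ = M * (r * ∫ s in (0 : ℝ)..t, g s) := by rw [intervalIntegral.integral_const_mul]; ring
    _ ≤ M * (Real.exp (lam * t) / (2 * Real.sqrt (c * lam))) :=
        mul_le_mul_of_nonneg_left (heatGain_le hc hlam hr) hM

end Heat

/-! ### The Leray-projected derivative symbol on `EuclideanSpace ℝ ι` -/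

section Symbol

variable {ι : Type*} [Fintype ι]

/-- Components are bounded by the Euclidean norm: `|ξ j| ≤ ‖ξ‖`. [folklore] -/
theorem abs_apply_le_norm (ξ : EuclideanSpace ℝ ι) (j : ι) : |ξ j| ≤ ‖ξ‖ := by
  simpa [Real.norm_eq_abs] using PiLp.norm_apply_le ξ j

/-- `∑ j (ξ j)² = ‖ξ‖²` on `EuclideanSpace ℝ ι`. [folklore] -/
theorem sum_sq_eq_norm_sq (ξ : EuclideanSpace ℝ ι) : ∑ j, ξ j ^ 2 = ‖ξ‖ ^ 2 :=
  (EuclideanSpace.real_norm_sq_eq ξ).symm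

/-- `|ξₖ ξₗ / ‖ξ‖²| ≤ 1`. [folklore] -/
theorem abs_mul_div_norm_sq_le_one (k l : ι) (ξ : EuclideanSpace ℝ ι) :
    |ξ k * ξ l / ‖ξ‖ ^ 2| ≤ 1 := by
  rcases eq_or_ne ‖ξ‖ 0 with h | h
  · simp [h]
  have hpos : 0 < ‖ξ‖ ^ 2 := by positivity
  rw [abs_div, abs_of_pos hpos, div_le_one hpos, abs_mul, sq]
  exact mul_le_mul (abs_apply_le_norm ξ k) (abs_apply_le_norm ξ l) (abs_nonneg _) (norm_nonneg _)

variable [DecidableEq ι]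

/-- The symbol `m_{jkl}(ξ) = ξⱼ (δₖₗ − ξₖ ξₗ / ‖ξ‖²)` of `ℙ ∂ⱼ` acting from component `k` to
component `l` (`ℙ` the Leray projector with symbol `δₖₗ − ξₖξₗ/‖ξ‖²`, cf.
`Literature.Analysis.FluidPDE.leraySymbol`; Lemarié-Rieusset 2016, §6.1). At `ξ = 0` the value is `0`
(Lean's `x / 0 = 0` and the factor `ξⱼ = 0`), which makes the symbol continuous. [folklore] -/
def lerayDerivSymbol (j k l : ι) (ξ : EuclideanSpace ℝ ι) : ℝ :=
  ξ j * ((if k = l then 1 else 0) - ξ k * ξ l / ‖ξ‖ ^ 2)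

/-- Unfolding `lerayDerivSymbol`. [folklore] -/
theorem lerayDerivSymbol_apply (j k l : ι) (ξ : EuclideanSpace ℝ ι) :
    lerayDerivSymbol j k l ξ = ξ j * ((if k = l then 1 else 0) - ξ k * ξ l / ‖ξ‖ ^ 2) := rfl

/-- The projector part is bounded by `2`: `|δₖₗ − ξₖξₗ/‖ξ‖²| ≤ 2`. [folklore] -/
theorem abs_leray_entry_le_two (k l : ι) (ξ : EuclideanSpace ℝ ι) :
    |(if k = l then (1 : ℝ) else 0) - ξ k * ξ l / ‖ξ‖ ^ 2| ≤ 2 := by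
  have h1 : |(if k = l then (1 : ℝ) else 0)| ≤ 1 := by split_ifs <;> simp
  calc |(if k = l then (1 : ℝ) else 0) - ξ k * ξ l / ‖ξ‖ ^ 2|
      ≤ |(if k = l then (1 : ℝ) else 0)| + |ξ k * ξ l / ‖ξ‖ ^ 2| := abs_sub _ _
    _ ≤ 1 + 1 := add_le_add h1 (abs_mul_div_norm_sq_le_one k l ξ)
    _ = 2 := by norm_num

/-- **Symbol bound** `|m_{jkl}(ξ)| ≤ 2‖ξ‖` (Lemarié-Rieusset 2016, §6.1: `ℙ` is bounded by `1`
on each frequency, `∂ⱼ` contributes `|ξⱼ| ≤ ‖ξ‖`). [folklore] -/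
theorem abs_lerayDerivSymbol_le (j k l : ι) (ξ : EuclideanSpace ℝ ι) :
    |lerayDerivSymbol j k l ξ| ≤ 2 * ‖ξ‖ := by
  rw [lerayDerivSymbol, abs_mul]
  calc |ξ j| * |(if k = l then (1 : ℝ) else 0) - ξ k * ξ l / ‖ξ‖ ^ 2| ≤ ‖ξ‖ * 2 :=
        mul_le_mul (abs_apply_le_norm ξ j) (abs_leray_entry_le_two k l ξ) (abs_nonneg _)
          (norm_nonneg _)
    _ = 2 * ‖ξ‖ := mul_comm _ _

/-- The symbol vanishes at the origin. [folklore] -/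
@[simp]
theorem lerayDerivSymbol_zero (j k l : ι) : lerayDerivSymbol j k l (0 : EuclideanSpace ℝ ι) = 0 := by
  simp [lerayDerivSymbol]

/-- The symbol is odd: `m_{jkl}(-ξ) = -m_{jkl}(ξ)`. [folklore] -/
theorem lerayDerivSymbol_neg (j k l : ι) (ξ : EuclideanSpace ℝ ι) :
    lerayDerivSymbol j k l (-ξ) = -lerayDerivSymbol j k l ξ := by
  simp only [lerayDerivSymbol, PiLp.neg_apply, norm_neg, neg_mul_neg]
  ring

/-- Away from the origin the symbol is continuous (a rational function of the coordinates with
non-vanishing denominator). [folklore] -/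
theorem continuousAt_lerayDerivSymbol_of_ne_zero (j k l : ι) {ξ : EuclideanSpace ℝ ι}
    (hξ : ξ ≠ 0) : ContinuousAt (lerayDerivSymbol j k l) ξ := by
  have hc : ∀ i : ι, Continuous fun ξ : EuclideanSpace ℝ ι => ξ i := fun i =>
    (EuclideanSpace.proj i).continuous
  have hn : ‖ξ‖ ^ 2 ≠ 0 := by positivity
  unfold lerayDerivSymbol
  apply ContinuousAt.mul (hc j).continuousAt
  apply ContinuousAt.sub continuousAt_const
  exact ((hc k).continuousAt.mul (hc l).continuousAt).div (by fun_prop) hn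

/-- **Continuity of the symbol** on all of `EuclideanSpace ℝ ι`: at `ξ = 0` by the squeeze
`|m_{jkl}(ξ)| ≤ 2‖ξ‖ → 0`. [folklore] -/
theorem continuous_lerayDerivSymbol (j k l : ι) : Continuous (lerayDerivSymbol j k l) := by
  rw [continuous_iff_continuousAt]
  intro ξ
  rcases eq_or_ne ξ 0 with rfl | hξ
  · rw [ContinuousAt, lerayDerivSymbol_zero]
    refine squeeze_zero_norm (a := fun ξ : EuclideanSpace ℝ ι => 2 * ‖ξ‖) (fun ξ => ?_) ?_
    · rw [Real.norm_eq_abs]; exact abs_lerayDerivSymbol_le j k l ξ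
    · have : Tendsto (fun ξ : EuclideanSpace ℝ ι => 2 * ‖ξ‖) (𝓝 0) (𝓝 (2 * ‖(0 : EuclideanSpace ℝ ι)‖)) :=
        (continuous_const.mul continuous_norm).continuousAt
      simpa using this
  · exact continuousAt_lerayDerivSymbol_of_ne_zero j k l hξ

/-- **Incompressibility of the projected term**: `∑ₗ ξₗ m_{jkl}(ξ) = 0`, i.e. the range of the
Leray symbol is orthogonal to `ξ` (Lemarié-Rieusset 2016, §6.1). [folklore] -/
theorem sum_mul_lerayDerivSymbol (j k : ι) (ξ : EuclideanSpace ℝ ι) :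
    ∑ l, ξ l * lerayDerivSymbol j k l ξ = 0 := by
  rcases eq_or_ne ‖ξ‖ 0 with h | h
  · have : ξ = 0 := norm_eq_zero.1 h
    simp [this]
  have hn : ‖ξ‖ ^ 2 ≠ 0 := by positivity
  simp only [lerayDerivSymbol]
  have h1 : ∀ l, ξ l * (ξ j * ((if k = l then 1 else 0) - ξ k * ξ l / ‖ξ‖ ^ 2)) =
      ξ j * ((if k = l then ξ l else 0) - ξ k * (ξ l ^ 2) / ‖ξ‖ ^ 2) := by
    intro l
    split_ifs <;> ring
  simp_rw [h1, ← Finset.mul_sum, Finset.sum_sub_distrib, Finset.sum_ite_eq, Finset.mem_univ,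
    if_true]
  rw [← Finset.sum_div, ← Finset.mul_sum, sum_sq_eq_norm_sq]
  field_simp
  ring

/-- The real symbol as a complex number (the form in which it multiplies Fourier coefficients). [folklore] -/
theorem norm_ofReal_lerayDerivSymbol_le (j k l : ι) (ξ : EuclideanSpace ℝ ι) :
    ‖(lerayDerivSymbol j k l ξ : ℂ)‖ ≤ 2 * ‖ξ‖ := by
  rw [Complex.norm_real, Real.norm_eq_abs]
  exact abs_lerayDerivSymbol_le j k l ξ

end Symbol

end Literature.Analysis.FluidPDE.FourierNS

end
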